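import Literature.NumberTheory.Sieve.BombieriFriedlanderIwaniecDispersionR1SecondBound
import Literature.NumberTheory.Sieve.BombieriFriedlanderIwaniecTheorem2Errors
import HarnessLib

/-!
# Bombieri–Friedlander–Iwaniec 1986, Theorem 2: the bound for `ℛ₁` (§9 assembled, modulo Lemma 7)

Topic `Literature/NumberTheory/Sieve`.  Part of the assembly of **Theorem 2** (the named fact
`Literature.NumberTheory.Sieve.BombieriFriedlanderIwaniecTheorem2`) of E. Bombieri, J. B. Friedlander,
H. Iwaniec, *Primes in arithmetic progressions to large moduli*, Acta Math. 156 (1986), 203–251.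
This file PROVES `BFI.e4_le`: the term `‖ℛ₁‖` of the skeleton (`BFI.dispG_le_errors`) is bounded
through the bridge `BFI.norm_calR1_le_two_mul_dispR1C` (`…DispersionR1Second`), the rigorous (9.13)
`BFI.norm_dispR1C_le` and the passage Lemma 7 ⇒ `BBoundHyp` (`BFI.bBoundHyp_of_lemma7`,
`…DispersionR1SecondBound`), for coefficients supported on squarefree integers.  The only external
input is **Lemma 7 for `𝓑_m`** (Deshouillers–Iwaniec), as the explicit hypothesis `h7` (both signs of
`a`); no named fact is introduced.

## Contents

* `BFI.sum_qSet_sq_le` (`Γ(q₀) ≤ ∑_{q∼Q} γ_q²`), `BFI.tMod_factor_le`, **`BFI.r1Factor_le`** (the factor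
  `E(q₀)` of (9.13) uniformly in `q₀ ≤ Q₀`), **`BFI.e4_le`**.

## References

* E. Bombieri, J. B. Friedlander, H. Iwaniec, Acta Math. 156 (1986), 203–251, §9 (9.1)–(9.21)
  pp. 227–231. [BombieriFriedlanderIwaniecActa1986]
-/

noncomputable section

open Finset Real MeasureTheory Complex
open scoped FourierTransform ArithmeticFunction.sigma

namespace Literature.NumberTheory.Sieve

namespace BFI

/-! ## E4: `‖ℛ₁‖` through the bridge, (9.13) and Lemma 7 -/

/-- `Γ(q₀) = ∑_{q₀q ∼ Q} γ_{q₀q}² ≤ ∑_{q' ∼ Q} γ_{q'}²` (`q₀ ≥ 1`). [folklore] -/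
theorem sum_qSet_sq_le {Q : ℝ} (γ : ℕ → ℝ) {q₀ : ℕ} (hq₀ : 0 < q₀) :
    ∑ q ∈ qSet Q q₀, γ (q₀ * q) ^ 2 ≤ ∑ q' ∈ dyadic Q, γ q' ^ 2 := by
  have hinj : Set.InjOn (fun q : ℕ => q₀ * q) (qSet Q q₀ : Set ℕ) := fun a _ b _ hab =>
    Nat.eq_of_mul_eq_mul_left hq₀ hab
  calc ∑ q ∈ qSet Q q₀, γ (q₀ * q) ^ 2 = ∑ q' ∈ (qSet Q q₀).image (fun q : ℕ => q₀ * q), γ q' ^ 2 := by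
        rw [Finset.sum_image hinj]
    _ ≤ _ := by
        refine Finset.sum_le_sum_of_subset_of_nonneg ?_ fun _ _ _ => sq_nonneg _
        intro q' hq'
        rw [Finset.mem_image] at hq'
        obtain ⟨q, hq, rfl⟩ := hq'
        unfold qSet at hq
        exact (Finset.mem_filter.1 hq).2

/-- The `T(q₀)`-factor of `r1Factor`: for `1 ≤ q₀ ≤ Q₀`, `N ≥ 1`,
`T⁻¹(2(q₀N+1) + T(1 + log T)) ≤ 2 + log(3Q₀N + 2)`. [folklore] -/
theorem tMod_factor_le {N Q₀ : ℝ} (hN : 1 ≤ N) {q₀ : ℕ} (hq₀ : 1 ≤ q₀) (hq₀Q : (q₀ : ℝ) ≤ Q₀) :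
    ((tMod N q₀ : ℕ) : ℝ)⁻¹ * (2 * ((q₀ : ℝ) * N + 1) + (tMod N q₀ : ℕ) * (1 + Real.log (tMod N q₀ : ℕ))) ≤
      2 + Real.log (3 * Q₀ * N + 2) := by
  have hq₀r : (1 : ℝ) ≤ q₀ := by exact_mod_cast hq₀
  have hT1 : (1 : ℝ) ≤ (tMod N q₀ : ℕ) := by exact_mod_cast tMod_pos N q₀
  have hT0 : (0 : ℝ) < (tMod N q₀ : ℕ) := by linarith
  -- `T ≥ (2q₀+1)N + 1 ≥ 2(q₀N+1)`
  have hTge : 2 * ((q₀ : ℝ) * N + 1) ≤ (tMod N q₀ : ℕ) := by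
    unfold tMod
    push_cast
    have h1 : (2 * (q₀ : ℝ) + 1) * N - 1 < (⌊(2 * (q₀ : ℝ) + 1) * N⌋₊ : ℝ) := by
      have := Nat.lt_floor_add_one ((2 * (q₀ : ℝ) + 1) * N); linarith
    nlinarith
  -- `T ≤ 3Q₀N + 2`
  have hTle : ((tMod N q₀ : ℕ) : ℝ) ≤ 3 * Q₀ * N + 2 := by
    unfold tMod
    push_cast
    have h1 : (⌊(2 * (q₀ : ℝ) + 1) * N⌋₊ : ℝ) ≤ (2 * (q₀ : ℝ) + 1) * N := Nat.floor_le (by positivity)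
    have h2 : (2 * (q₀ : ℝ) + 1) * N ≤ 3 * Q₀ * N := by nlinarith
    linarith
  have hlogT : Real.log (tMod N q₀ : ℕ) ≤ Real.log (3 * Q₀ * N + 2) := Real.log_le_log hT0 hTle
  have hlog0 : 0 ≤ Real.log (tMod N q₀ : ℕ) := Real.log_nonneg hT1
  have e : ((tMod N q₀ : ℕ) : ℝ)⁻¹ * (2 * ((q₀ : ℝ) * N + 1) + (tMod N q₀ : ℕ) * (1 + Real.log (tMod N q₀ : ℕ))) =
      ((tMod N q₀ : ℕ) : ℝ)⁻¹ * (2 * ((q₀ : ℝ) * N + 1)) + (1 + Real.log (tMod N q₀ : ℕ)) := by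
    field_simp
  rw [e]
  have h3 : ((tMod N q₀ : ℕ) : ℝ)⁻¹ * (2 * ((q₀ : ℝ) * N + 1)) ≤ 1 := by
    rw [inv_mul_le_iff₀ hT0]; linarith
  linarith

/-- **`E(q₀)` bounded uniformly in `q₀ ≤ Q₀`**: for `0 < Y ≤ M`, `N ≥ 1`, `Q > 0`, `R > 0`,
`1 ≤ q₀ ≤ Q₀`, `∑_{q∼Q}γ_q² ≤ Γ_Q`, `L ≥ 0`,
`r1Factor(q₀) ≤ (3MQ₀/(Q²R)) · 2π(8(M+2Y)B₀)^{1/2} · (2 + log(3Q₀N+2)) · ((N/R)^{1/2} Γ_Q ‖β‖) · (D_τ L)^{1/2}`.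
[folklore] -/
theorem r1Factor_le {M Y N Q R Q₀ ΓQ L : ℝ} (hY : 0 < Y) (hYM : Y ≤ M) (hN : 1 ≤ N) (hQ : 0 < Q)
    (hR : 0 < R) {β γ : ℕ → ℝ} (hΓQ : ∑ q ∈ dyadic Q, γ q ^ 2 ≤ ΓQ) (Dτ : ℕ)
    {q₀ : ℕ} (hq₀ : 1 ≤ q₀) (hq₀Q : (q₀ : ℝ) ≤ Q₀) :
    r1Factor M Y N Q R β γ Dτ L q₀ ≤
      (3 * M * Q₀ / (Q ^ 2 * R)) * (2 * π * Real.sqrt (8 * (M + 2 * Y) * fourierDecayConst Y)) *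
        (2 + Real.log (3 * Q₀ * N + 2)) *
        ((Real.sqrt (N / R) * ΓQ * Real.sqrt (l2Sq N β)) * Real.sqrt (Dτ * L)) := by
  have hM : 0 ≤ M := hY.le.trans hYM
  have hq₀0 : 0 < q₀ := hq₀
  have hQ₀0 : 0 ≤ Q₀ := le_trans (Nat.cast_nonneg _) hq₀Q
  have hΓ0 : 0 ≤ ∑ q ∈ qSet Q q₀, γ (q₀ * q) ^ 2 := Finset.sum_nonneg fun _ _ => sq_nonneg _
  have hΓ : ∑ q ∈ qSet Q q₀, γ (q₀ * q) ^ 2 ≤ ΓQ := (sum_qSet_sq_le γ hq₀0).trans hΓQ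
  have hΓQ0 : 0 ≤ ΓQ := hΓ0.trans hΓ
  have hl2 : 0 ≤ l2Sq N β := l2Sq_nonneg N β
  unfold r1Factor
  have hT := tMod_factor_le hN hq₀ hq₀Q (Q₀ := Q₀)
  have hTnn : 0 ≤ ((tMod N q₀ : ℕ) : ℝ)⁻¹ * (2 * ((q₀ : ℝ) * N + 1) +
      (tMod N q₀ : ℕ) * (1 + Real.log (tMod N q₀ : ℕ))) := by
    have hT1 : (1 : ℝ) ≤ (tMod N q₀ : ℕ) := by exact_mod_cast tMod_pos N q₀
    have := Real.log_nonneg hT1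
    positivity
  -- the square root factor
  have hsq : Real.sqrt (⌊N / R⌋₊ * ((∑ q ∈ qSet Q q₀, γ (q₀ * q) ^ 2) *
      (∑ q ∈ qSet Q q₀, γ (q₀ * q) ^ 2) * ∑ n ∈ dyadic N, β n ^ 2)) ≤
      Real.sqrt (N / R) * ΓQ * Real.sqrt (l2Sq N β) := by
    have hfl : (⌊N / R⌋₊ : ℝ) ≤ N / R := Nat.floor_le (by positivity)
    have e : Real.sqrt (N / R) * ΓQ * Real.sqrt (l2Sq N β) = Real.sqrt ((N / R) * (ΓQ * ΓQ * l2Sq N β)) := by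
      rw [Real.sqrt_mul (by positivity), Real.sqrt_mul (by positivity), Real.sqrt_mul_self hΓQ0]; ring
    rw [e]
    refine Real.sqrt_le_sqrt (mul_le_mul hfl ?_ (by positivity) (by positivity))
    unfold l2Sq
    exact mul_le_mul_of_nonneg_right (mul_le_mul hΓ hΓ hΓ0 hΓQ0) (Finset.sum_nonneg fun _ _ => sq_nonneg _)
  have hV : 3 * M * q₀ / (Q ^ 2 * R) ≤ 3 * M * Q₀ / (Q ^ 2 * R) :=
    div_le_div_of_nonneg_right (by nlinarith) (by positivity)
  have hsq0 : 0 ≤ Real.sqrt (⌊N / R⌋₊ * ((∑ q ∈ qSet Q q₀, γ (q₀ * q) ^ 2) *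
      (∑ q ∈ qSet Q q₀, γ (q₀ * q) ^ 2) * ∑ n ∈ dyadic N, β n ^ 2)) := Real.sqrt_nonneg _
  have hlog3 : 0 ≤ Real.log (3 * Q₀ * N + 2) := Real.log_nonneg (by nlinarith)
  refine mul_le_mul (mul_le_mul (mul_le_mul_of_nonneg_right hV (by positivity)) hT hTnn (by positivity))
    (mul_le_mul_of_nonneg_right hsq (Real.sqrt_nonneg _)) (by positivity) (by positivity)

/-- **E4** (BFI §9 complete, modulo Lemma 7): for `a ≠ 0`, `0 < Y ≤ M`, `N ≥ 1`, `Q ≥ 1/2`, `R > 0`,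
`N/R ≥ 1`, `1 ≤ Q₀`, `H ≥ 1` (an integer), `β` supported on squarefree `n ∼ N` with
`τ(n) ≤ D` there, `τ(c) ≤ D_τ` for `c ≤ 4NQ`, `∑_{q∼Q}γ_q² ≤ Γ_Q`, and Lemma 7 for `𝓑_m` (both signs
of `a`, constant `C₇`, exponent `η`),
`‖ℛ₁‖ ≤ 2 Q₀ τ(|a|) · 2(2log(N/R) + 1) · E*`, with `E*` the uniform bound of `BFI.r1Factor_le` at
`L = C₇ · lemma7Rhs(4NQ, 2Q, N/R, H, 2N; η; ‖β‖², D∑β⁴)`.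
[cite: BombieriFriedlanderIwaniecActa1986, §9 (9.1)–(9.21) pp. 227–231] -/
theorem e4_le {a : ℤ} (ha : a ≠ 0) {η C₇ : ℝ}
    (h7 : ∀ a' : ℤ, (a' = a ∨ a' = -a) → ∀ m : ℕ, 0 < m → ∀ C D K H N' : ℝ,
      1 ≤ C → 1 ≤ D → 1 ≤ K → 1 ≤ H → 1 ≤ N' → ∀ (b : ℕ → ℝ) (β' : ℕ → ℕ → ℂ),
        (∀ h n, ‖β' h n‖ ≤ |b n|) →
          dispBm a' m C D K H N' β' ≤ C₇ * lemma7Rhs C D K H N' η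
            (∑ n ∈ Icc 1 ⌊N'⌋₊, b n ^ 2) (∑ n ∈ Icc 1 ⌊N'⌋₊, (rho n : ℝ) * b n ^ 4))
    (hC₇ : 0 ≤ C₇) {M Y N Q R Q₀ ΓQ D : ℝ} (hY : 0 < Y) (hYM : Y ≤ M) (hN : 1 ≤ N)
    (hQ : 1 / 2 ≤ Q) (hR : 0 < R) (hNR : 1 ≤ N / R) (hQ₀ : 1 ≤ Q₀) {Hn : ℕ} (hH : 1 ≤ Hn)
    {β γ : ℕ → ℝ} (hsf : ∀ n ∈ dyadic N, β n ≠ 0 → Squarefree n)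
    (hD : ∀ n ∈ dyadic N, (n.divisors.card : ℝ) ≤ D) {Dτ : ℕ}
    (hDτ : ∀ c ∈ Icc 1 ⌊4 * N * Q⌋₊, c.divisors.card ≤ Dτ) (hΓQ : ∑ q ∈ dyadic Q, γ q ^ 2 ≤ ΓQ) :
    ‖calR1 a M Y N Q R Q₀ β γ Hn‖ ≤
      2 * (Q₀ * ((a.natAbs.divisors.card : ℝ) * 2 * (2 * Real.log (N / R) + 1) *
        ((3 * M * Q₀ / (Q ^ 2 * R)) * (2 * π * Real.sqrt (8 * (M + 2 * Y) * fourierDecayConst Y)) *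
          (2 + Real.log (3 * Q₀ * N + 2)) *
          ((Real.sqrt (N / R) * ΓQ * Real.sqrt (l2Sq N β)) *
            Real.sqrt (Dτ * (C₇ * lemma7Rhs (4 * N * Q) (2 * Q) (N / R) Hn (2 * N) η (l2Sq N β)
              (D * ∑ n ∈ dyadic N, β n ^ 4))))))) := by
  have hM : 0 ≤ M := hY.le.trans hYM
  have hN0 : 0 ≤ N := by linarith
  have hQ0 : 0 < Q := by linarith
  have hQ₀0 : 0 < Q₀ := by linarith
  have ha' : -a ≠ 0 := neg_ne_zero.2 ha
  -- Lemma 7 for `-a`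
  have h7' : ∀ a' : ℤ, (a' = -a ∨ a' = -(-a)) → ∀ m : ℕ, 0 < m → ∀ C D K H N' : ℝ,
      1 ≤ C → 1 ≤ D → 1 ≤ K → 1 ≤ H → 1 ≤ N' → ∀ (b : ℕ → ℝ) (β' : ℕ → ℕ → ℂ),
        (∀ h n, ‖β' h n‖ ≤ |b n|) →
          dispBm a' m C D K H N' β' ≤ C₇ * lemma7Rhs C D K H N' η
            (∑ n ∈ Icc 1 ⌊N'⌋₊, b n ^ 2) (∑ n ∈ Icc 1 ⌊N'⌋₊, (rho n : ℝ) * b n ^ 4) := by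
    intro a' ha'eq
    refine h7 a' ?_
    rcases ha'eq with h | h
    · exact Or.inr h
    · exact Or.inl (by rw [h, neg_neg])
  set L : ℝ := C₇ * lemma7Rhs (4 * N * Q) (2 * Q) (N / R) Hn (2 * N) η (l2Sq N β)
    (D * ∑ n ∈ dyadic N, β n ^ 4) with hLdef
  have hBB : BBoundHyp (-a) N Q R Hn β L :=
    bBoundHyp_of_lemma7 h7' hC₇ hN hQ hR hNR (by exact_mod_cast hH) β hsf hD
  -- `L ≥ 0` (from `BBoundHyp` at the zero twist)
  have hL0 : 0 ≤ L := by
    have h := hBB (-a) (Or.inl rfl) 1 Nat.one_pos (fun _ _ => 0) (fun _ _ => by simp) (fun _ _ _ => rfl)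
    exact le_trans (dispBm_nonneg _ _ _ _ _ _ _ _) h
  have hbridge := norm_calR1_le_two_mul_dispR1C a M Y hN0 hQ0.le hR.le Q₀ β γ Hn
  have hdisp := norm_dispR1C_le ha' hY hYM hN hQ0 hR Q₀ (by positivity : (0 : ℝ) ≤ (Hn : ℝ)) β γ hDτ hBB
  refine hbridge.trans (mul_le_mul_of_nonneg_left (hdisp.trans ?_) (by norm_num))
  -- sum over `q₀ ≤ Q₀`
  have hlog2 : (Nat.log 2 ⌊N / R⌋₊ : ℝ) ≤ 2 * Real.log (N / R) := by
    refine (natLog_two_le _).trans ?_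
    have h1 : (1 : ℝ) ≤ ⌊N / R⌋₊ := by exact_mod_cast Nat.le_floor (by exact_mod_cast hNR)
    have h2 : (⌊N / R⌋₊ : ℝ) ≤ N / R := Nat.floor_le (by positivity)
    have := Real.log_le_log (by linarith) h2
    linarith
  have hnatabs : ((-a).natAbs.divisors.card : ℝ) = (a.natAbs.divisors.card : ℝ) := by rw [Int.natAbs_neg]
  have hlogNR : 0 ≤ Real.log (N / R) := Real.log_nonneg hNR
  set E : ℝ := (3 * M * Q₀ / (Q ^ 2 * R)) * (2 * π * Real.sqrt (8 * (M + 2 * Y) * fourierDecayConst Y)) *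
    (2 + Real.log (3 * Q₀ * N + 2)) * ((Real.sqrt (N / R) * ΓQ * Real.sqrt (l2Sq N β)) * Real.sqrt (Dτ * L))
    with hE
  have hE0 : 0 ≤ E := by
    have hΓQ0 : 0 ≤ ΓQ := le_trans (Finset.sum_nonneg fun _ _ => sq_nonneg _) hΓQ
    have : 0 ≤ Real.log (3 * Q₀ * N + 2) := Real.log_nonneg (by nlinarith)
    positivity
  have hterm : ∀ q₀ ∈ Icc 1 ⌊Q₀⌋₊, ((-a).natAbs.divisors.card : ℝ) * 2 * (Nat.log 2 ⌊N / R⌋₊ + 1) *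
      r1Factor M Y N Q R β γ Dτ L q₀ ≤ (a.natAbs.divisors.card : ℝ) * 2 * (2 * Real.log (N / R) + 1) * E := by
    intro q₀ hq₀
    rw [Finset.mem_Icc] at hq₀
    have hq₀Q : (q₀ : ℝ) ≤ Q₀ := le_trans (by exact_mod_cast hq₀.2) (Nat.floor_le (by linarith))
    have hr := r1Factor_le hY hYM hN hQ0 hR hΓQ Dτ hq₀.1 hq₀Q (β := β) (L := L)
    have hr0 := r1Factor_nonneg Y Q hM hN0 hR.le β γ Dτ L q₀ (M := M) (N := N) (R := R)
    rw [hnatabs]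
    have hlg0 : (0 : ℝ) ≤ (Nat.log 2 ⌊N / R⌋₊ : ℝ) := Nat.cast_nonneg _
    exact mul_le_mul (mul_le_mul_of_nonneg_left (by linarith) (by positivity)) hr hr0 (by positivity)
  calc _ ≤ ∑ q₀ ∈ Icc 1 ⌊Q₀⌋₊, (a.natAbs.divisors.card : ℝ) * 2 * (2 * Real.log (N / R) + 1) * E :=
        Finset.sum_le_sum hterm
    _ = (⌊Q₀⌋₊ : ℝ) * ((a.natAbs.divisors.card : ℝ) * 2 * (2 * Real.log (N / R) + 1) * E) := by
        rw [Finset.sum_const, Nat.card_Icc, nsmul_eq_mul]; push_cast; simp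
    _ ≤ Q₀ * ((a.natAbs.divisors.card : ℝ) * 2 * (2 * Real.log (N / R) + 1) * E) := by
        refine mul_le_mul_of_nonneg_right (Nat.floor_le (by linarith)) (by positivity)
    _ = _ := by rw [hE]

end BFI

end Literature.NumberTheory.Sieve
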